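import Mathlib
import Literature.Analysis.FluidPDE.VectorCalculus
import Literature.Analysis.FluidPDE.VorticityStretching
import Summits.NavierStokesRegularity.NavierStokesRegularity.Theorems.ThreadingFluxCentreJetDefs
import Summits.NavierStokesRegularity.NavierStokesRegularity.Theorems.ThreadingFluxPlatonicDefs
import Summits.NavierStokesRegularity.NavierStokesRegularity.Theorems.ThreadingFluxPlatonicSymmetryAlgebra
import Summits.NavierStokesRegularity.NavierStokesRegularity.Theorems.ThreadingFluxPlatonicCentreJetAlgebra
import Summits.NavierStokesRegularity.NavierStokesRegularity.Theorems.ThreadingFluxPlatonicCentreJetFlat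
import Summits.NavierStokesRegularity.NavierStokesRegularity.Theorems.ThreadingFluxPlatonicCentreJetCubicAlgebra
import HarnessLib

/-!
# Crux `PoloidalLiouville` (stmt-NavierStokesRegularity-1222, wall W1), crux idea «platonic-germ-sieve» (ns-idea-15 g11, V27):
# (J4) THE CUBIC JET OF THE O-CLASS, AND (J4′) VORTICITY 3-FLATNESS FROM UNTHREADEDNESS

Support file (Theorems-side; seat ns-wall-eng-7 g11, cell `ns-wall-extremal`, W1 adjunct; director-ns g19 p124 GO; critic ns-wall-crit-1
g8 BATCH #27 S–M / NO STRIKE; `--supports stmt-NavierStokesRegularity-1222 --as helper`; 0 kit).  The sequel of ns-wall-eng-7 g9's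
(J0)–(J3) (`ThreadingFluxPlatonicCentreJetFlat.lean`, p724668) by ONE order, with NO Navier–Stokes input, over the trilinear algebra of
`ThreadingFluxPlatonicCentreJetCubicAlgebra.lean` (`CentreFlat.trilin_eq`, `trilin_trace`, `trilin_eq_zero_of_inner_self`).  For `V : ℝ³ → ℝ³`
on `ball 0 ρ`, O-equivariant there in the EXACT binder of `Platonic.OctahedralCentreRigidity`:

* `fderiv_fderiv_fderiv_equivariant` (third transport on the ball), `fderiv3_centre_symm` / `fderiv3_centre_comm` (`D³F(0)` is a
  symmetric trilinear map commuting with the generators);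
* ★ (J4) `fderiv3_centre_apply` — `V ∈ C³`: `D³V(0)(u,v,w) = B·(⟪u,v⟫w + ⟪v,w⟫u + ⟪w,u⟫v) + (A − 3B)·(uᵢvᵢwᵢ)ᵢ`,
  `A = D³V(0)(e₀,e₀,e₀)₀`, `B = D³V(0)(e₀,e₀,e₁)₁`: the cubic Taylor jet lies in the plane `span{∇‖x‖⁴, ∇Σxᵢ⁴}` (all gradients — consistent
  with g9's (J3) `D²(curl V)(0) = 0`);
* `fderiv3_trace_eq_zero_of_divFree` (`div V = 0` on the ball ⇒ `Σᵢ D³V(0)(u,w,eᵢ)ᵢ = 0`) and ★ `fderiv3_centre_apply_of_divFree`: then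
  `A + 2B = 0` and `D³V(0)(u,v,w) = B·(⟪u,v⟫w + ⟪v,w⟫u + ⟪w,u⟫v − 5(uᵢvᵢwᵢ)ᵢ) = −(5B/24)·D³(∇h₄)(0)(u,v,w)`, `h₄ = Σxᵢ⁴ − (3/5)‖x‖⁴` the
  O-invariant HARMONIC quartic — the cubic jet of a divergence-free O-germ is ONE multiple of `∇h₄`;
* `inner_fderiv3_self_eq_zero_of_tangent` — `F ∈ C³`, `F 0 = 0`, `⟪x, F x⟫ = 0` on the ball ⇒ `⟪u, D³F(0)(u,u,u)⟫ = 0` (along the ray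
  `t ↦ tu`, `⟪u, F(tu)⟫ = t⁻¹⟪tu, F(tu)⟫` vanishes near `0`, hence so do its first three derivatives; three chain rules);
* ★★ (J4′) `fderiv3_curl_centre_eq_zero` — `V ∈ C⁴`, O-equivariant AND UNTHREADED about `0` on the ball (`⟪x, curl V x⟫ = 0`, the binder
  of `OctahedralCentreRigidity`): **`D³(curl V)(0) = 0`, the vorticity is 3-FLAT at the centre** (`ω = curl V` is O-equivariant on the ball by
  g9's `curl_equivariant_*`, so `D³ω(0)` has the normal form; tangency gives `⟪u, D³ω(0)(u,u,u)⟫ = (A − 3B)Σuᵢ⁴ + 3B‖u‖⁴ ≡ 0`, which kills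
  `A` and `B`).  One order beyond (J3); the FIRST order at which unthreadedness acts.  Global forms: `fderiv3_centre_apply_of_isEquivariant`,
  `curl_three_flat_of_isEquivariant` (the 3-jet of `ω` vanishes at the centre).

SHARPNESS at order four (remark, not formalised; critic BATCH #27 (d)): `x × ∇h₄` is O-equivariant with `curl(x × ∇h₄) = −5∇h₄ ≠ 0` — a
genuinely vortical quartic slot — and it is exactly what unthreadedness removes next (`⟪x, curl(x × ∇h₄)⟫ = −20h₄`); dually `curl(h₄x) = ∇h₄ × x`
is tangent with a non-zero 4-jet.  So the kinematic sieve (symmetry + incompressibility + tangency) is exhausted at vorticity order four, the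
custodian's first vortical slot β (`Cruxes/PoloidalLiouville/PlatonicSieveResults.md` §1): steady NS has to act from there.  REGULARITY used:
three (four for (J4′)) derivatives of `V` on the open ball, the top one continuous; `ContDiffOn ℝ 3` / `4` is the lineage convention.
HONEST LABEL: representation-theoretic/kinematic information strictly below W1 (no NS input), W1 movement 0; no Prop of the sketch is closed;
`OctahedralCentreRigidity`, `PoloidalLiouville` (1222), `UnthreadedRigidity` (27585) and NS regularity are OPEN — NOT proved.  [folklore]
-/

-- the summit and its single sub-problem share the name (CONVENTIONS §1)
set_option linter.dupNamespace false

noncomputable section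

open Set Function Filter Metric
open scoped RealInnerProductSpace Topology
open Literature.Analysis.FluidPDE
open Summit.NavierStokesRegularity.NavierStokesRegularity.Theorems.PoloidalLiouville.CentreJet (E3)

namespace Summit.NavierStokesRegularity.NavierStokesRegularity.Theorems.PoloidalLiouville.Platonic

namespace CentreFlat

section Eval

variable {X : Type*} [NormedAddCommGroup X] [NormedSpace ℝ X]

/-- Evaluation commutes with differentiation: `D(z ↦ G(z)[w])(y)[v] = DG(y)[v][w]`. -/
theorem fderiv_eval_eq {G : E3 → E3 →L[ℝ] X} {y : E3} (hy : DifferentiableAt ℝ G y) (w v : E3) :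
    fderiv ℝ (fun z => G z w) y v = fderiv ℝ G y v w := by
  rw [fderiv_clm_apply hy (differentiableAt_const w)]
  simp

/-- Double evaluation commutes with differentiation: `D(z ↦ G(z)[v][u])(y)[w] = DG(y)[w][v][u]`. -/
theorem fderiv_eval₂_eq {G : E3 → E3 →L[ℝ] E3 →L[ℝ] X} {y : E3} (hy : DifferentiableAt ℝ G y) (v u w : E3) :
    fderiv ℝ (fun z => G z v u) y w = fderiv ℝ G y w v u := by
  have h1 : fderiv ℝ (fun z => (fun z' => G z' v) z u) y w = fderiv ℝ (fun z' => G z' v) y w u :=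
    fderiv_eval_eq (hy.clm_apply (differentiableAt_const v)) u w
  have h2 : fderiv ℝ (fun z' => G z' v) y w = fderiv ℝ G y w v := fderiv_eval_eq hy v w
  simpa [h2] using h1

/-- A continuous linear functional of a map that vanishes on the ball annihilates the map's derivative there. -/
theorem apply_fderiv_eq_zero_of_forall_eq_zero (Λ : X →L[ℝ] ℝ) {H : E3 → X} {ρ : ℝ} {x : E3}
    (hx : x ∈ ball (0 : E3) ρ) (hH : DifferentiableAt ℝ H x) (hk : ∀ y ∈ ball (0 : E3) ρ, Λ (H y) = 0) (w : E3) :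
    Λ (fderiv ℝ H x w) = 0 := by
  have h1 : HasFDerivAt (fun y => Λ (H y)) (Λ.comp (fderiv ℝ H x)) x := Λ.hasFDerivAt.comp x hH.hasFDerivAt
  have h2 : HasFDerivAt (fun y => Λ (H y)) (0 : E3 →L[ℝ] ℝ) x := by
    refine (hasFDerivAt_const (0 : ℝ) x).congr_of_eventuallyEq ?_
    filter_upwards [isOpen_ball.mem_nhds hx] with y hy
    exact hk y hy
  have h := congrArg (fun T : E3 →L[ℝ] ℝ => T w) (h1.unique h2)
  simpa using h

/-- The chain rule along a ray: `d/ds G(s u) |ₛ₌ₜ = DG(t u)[u]`. -/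
theorem hasDerivAt_ray {G : E3 → X} {u : E3} {t : ℝ} (hG : DifferentiableAt ℝ G (t • u)) :
    HasDerivAt (fun s : ℝ => G (s • u)) (fderiv ℝ G (t • u) u) t := by
  have h := hG.hasFDerivAt.comp_hasDerivAt t ((hasDerivAt_id t).smul_const u)
  simpa [Function.comp_def] using h

end Eval
/-- If `f` vanishes near `0` and has derivative `f' t` at every `t` near `0`, then `f'` vanishes near `0`. -/
theorem eventuallyEq_zero_of_hasDerivAt {f f' : ℝ → ℝ} (hf : ∀ᶠ t in 𝓝 (0 : ℝ), HasDerivAt f (f' t) t)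
    (h0 : f =ᶠ[𝓝 (0 : ℝ)] 0) : f' =ᶠ[𝓝 (0 : ℝ)] 0 := by
  have h0' : ∀ᶠ t in 𝓝 (0 : ℝ), f =ᶠ[𝓝 t] 0 := h0.eventually_nhds
  filter_upwards [hf, h0'] with t ht ht0
  have hc : HasDerivAt f 0 t := (hasDerivAt_const t (0 : ℝ)).congr_of_eventuallyEq ht0
  exact ht.unique hc

section Engine

variable {F : E3 → E3} {ρ : ℝ} {σ : Equiv.Perm (Fin 3)} {s : Fin 3 → ℝ}

/-- Third transport: `D³F(g x)[g w, g v, g u] = g (D³F(x)[w, v, u])` on the ball, for a rotation of the cube `g` under which `F` is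
equivariant on the ball. -/
theorem fderiv_fderiv_fderiv_equivariant (hF : ContDiffOn ℝ 3 F (ball 0 ρ)) (hd : IsCubeRotationData σ s)
    (heq : ∀ x ∈ ball (0 : E3) ρ, F (cubeRot σ s x) = cubeRot σ s (F x)) {x : E3} (hx : x ∈ ball (0 : E3) ρ)
    (w v u : E3) :
    fderiv ℝ (fderiv ℝ (fderiv ℝ F)) (cubeRot σ s x) (cubeRot σ s w) (cubeRot σ s v) (cubeRot σ s u) =
      cubeRot σ s (fderiv ℝ (fderiv ℝ (fderiv ℝ F)) x w v u) := by
  obtain ⟨L, hL⟩ := exists_clm_cubeRot σ s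
  have hF2 : ContDiffOn ℝ 2 (fderiv ℝ F) (ball 0 ρ) := hF.fderiv_of_isOpen isOpen_ball (by norm_num)
  have hW : ContDiffOn ℝ 1 (fderiv ℝ (fderiv ℝ F)) (ball 0 ρ) := hF2.fderiv_of_isOpen isOpen_ball (by norm_num)
  have hWd : ∀ y ∈ ball (0 : E3) ρ, DifferentiableAt ℝ (fderiv ℝ (fderiv ℝ F)) y := fun y hy =>
    (hW.differentiableOn one_ne_zero).differentiableAt (isOpen_ball.mem_nhds hy)
  -- the second transport as an identity of functions near `x`
  have hev : ∀ᶠ y in 𝓝 x, (fun z => fderiv ℝ (fderiv ℝ F) z (L v) (L u)) (L y) =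
      L ((fun z => fderiv ℝ (fderiv ℝ F) z v u) y) := by
    filter_upwards [isOpen_ball.mem_nhds hx] with y hy
    simp only [hL]
    exact fderiv_fderiv_equivariant (hF.of_le (by norm_num)) hd heq hy v u
  have h₁ : DifferentiableAt ℝ (fun z => fderiv ℝ (fderiv ℝ F) z (L v) (L u)) (L x) := by
    simp only [hL]
    exact ((hWd _ (cubeRot_mem_ball hd hx)).clm_apply (differentiableAt_const _)).clm_apply (differentiableAt_const _)
  have h₂ : DifferentiableAt ℝ (fun z => fderiv ℝ (fderiv ℝ F) z v u) x :=
    ((hWd x hx).clm_apply (differentiableAt_const _)).clm_apply (differentiableAt_const _)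
  have key := fderiv_transport L hev h₁ h₂ w
  rw [fderiv_eval₂_eq (by rw [hL]; exact hWd _ (cubeRot_mem_ball hd hx)), fderiv_eval₂_eq (hWd x hx)] at key
  simpa only [hL] using key

/-- `D³F(0)` is SYMMETRIC in its three slots (`F ∈ C³` near `0`): slots 1–2 by the symmetry of `D²(DF)(0)`, slots 2–3 by differentiating
the symmetry of `D²F(z)` in `z`. -/
theorem fderiv3_centre_symm (hρ : 0 < ρ) (hF : ContDiffOn ℝ 3 F (ball 0 ρ)) :
    (∀ u v w : E3, fderiv ℝ (fderiv ℝ (fderiv ℝ F)) 0 u v w = fderiv ℝ (fderiv ℝ (fderiv ℝ F)) 0 v u w) ∧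
      ∀ u v w : E3, fderiv ℝ (fderiv ℝ (fderiv ℝ F)) 0 u v w = fderiv ℝ (fderiv ℝ (fderiv ℝ F)) 0 u w v := by
  have hF2 : ContDiffOn ℝ 2 (fderiv ℝ F) (ball 0 ρ) := hF.fderiv_of_isOpen isOpen_ball (by norm_num)
  have hF2' : ContDiffOn ℝ 2 F (ball 0 ρ) := hF.of_le (by norm_num)
  have hW : ContDiffOn ℝ 1 (fderiv ℝ (fderiv ℝ F)) (ball 0 ρ) := hF2.fderiv_of_isOpen isOpen_ball (by norm_num)
  have hWd : DifferentiableAt ℝ (fderiv ℝ (fderiv ℝ F)) 0 :=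
    (hW.differentiableOn one_ne_zero).differentiableAt (isOpen_ball.mem_nhds (mem_ball_self hρ))
  refine ⟨fun u v w => ?_, fun u v w => ?_⟩
  · have h := (hF2.contDiffAt (isOpen_ball.mem_nhds (mem_ball_self hρ))).isSymmSndFDerivAt (by simp) u v
    rw [h]
  · have hev : (fun z => fderiv ℝ (fderiv ℝ F) z v w) =ᶠ[𝓝 0] fun z => fderiv ℝ (fderiv ℝ F) z w v := by
      filter_upwards [isOpen_ball.mem_nhds (mem_ball_self hρ)] with z hz
      exact (hF2'.contDiffAt (isOpen_ball.mem_nhds hz)).isSymmSndFDerivAt (by simp) v w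
    rw [← fderiv_eval₂_eq hWd v w u, ← fderiv_eval₂_eq hWd w v u, hev.fderiv_eq]

/-- `D³F(0)` COMMUTES with every rotation of the cube under which `F` is equivariant on the ball. -/
theorem fderiv3_centre_comm (hρ : 0 < ρ) (hF : ContDiffOn ℝ 3 F (ball 0 ρ)) (hd : IsCubeRotationData σ s)
    (heq : ∀ x ∈ ball (0 : E3) ρ, F (cubeRot σ s x) = cubeRot σ s (F x)) (u v w : E3) :
    fderiv ℝ (fderiv ℝ (fderiv ℝ F)) 0 (cubeRot σ s u) (cubeRot σ s v) (cubeRot σ s w) =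
      cubeRot σ s (fderiv ℝ (fderiv ℝ (fderiv ℝ F)) 0 u v w) := by
  have h := fderiv_fderiv_fderiv_equivariant hF hd heq (mem_ball_self hρ) u v w
  rwa [cubeRot_zero] at h

/-- **The cubic jet of a `C³` field equivariant on the ball under the four generators** (half-turns about `e₀`, `e₁`, 3-cycle,
quarter-turn): `D³F(0)(u,v,w) = B·(⟪u,v⟫ w + ⟪v,w⟫ u + ⟪w,u⟫ v) + (A − 3B)·(uᵢvᵢwᵢ)ᵢ`. -/
theorem fderiv3_centre_apply_of_generators (hρ : 0 < ρ) (hF : ContDiffOn ℝ 3 F (ball 0 ρ))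
    (h0 : ∀ x ∈ ball (0 : E3) ρ, F (cubeRot 1 ![1, -1, -1] x) = cubeRot 1 ![1, -1, -1] (F x))
    (h1 : ∀ x ∈ ball (0 : E3) ρ, F (cubeRot 1 ![-1, 1, -1] x) = cubeRot 1 ![-1, 1, -1] (F x))
    (hc : ∀ x ∈ ball (0 : E3) ρ, F (cubeRot (finRotate 3) (fun _ => 1) x) = cubeRot (finRotate 3) (fun _ => 1) (F x))
    (hq : ∀ x ∈ ball (0 : E3) ρ, F (cubeRot (Equiv.swap 0 1) ![-1, 1, 1] x) = cubeRot (Equiv.swap 0 1) ![-1, 1, 1] (F x))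
    (u v w : E3) :
    fderiv ℝ (fderiv ℝ (fderiv ℝ F)) 0 u v w =
      fderiv ℝ (fderiv ℝ (fderiv ℝ F)) 0 (EuclideanSpace.single 0 (1 : ℝ)) (EuclideanSpace.single 0 (1 : ℝ))
            (EuclideanSpace.single 1 (1 : ℝ)) 1 •
          (⟪u, v⟫ • w + ⟪v, w⟫ • u + ⟪w, u⟫ • v) +
        (fderiv ℝ (fderiv ℝ (fderiv ℝ F)) 0 (EuclideanSpace.single 0 (1 : ℝ)) (EuclideanSpace.single 0 (1 : ℝ))
              (EuclideanSpace.single 0 (1 : ℝ)) 0 -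
            3 * fderiv ℝ (fderiv ℝ (fderiv ℝ F)) 0 (EuclideanSpace.single 0 (1 : ℝ)) (EuclideanSpace.single 0 (1 : ℝ))
              (EuclideanSpace.single 1 (1 : ℝ)) 1) •
          WithLp.toLp 2 (fun i => u i * v i * w i) := by
  obtain ⟨hsym, hsym'⟩ := fderiv3_centre_symm hρ hF
  exact trilin_eq hsym hsym' (fderiv3_centre_comm hρ hF isCubeRotationData_halfTurn₀ h0)
    (fderiv3_centre_comm hρ hF isCubeRotationData_halfTurn₁ h1) (fderiv3_centre_comm hρ hF isCubeRotationData_cycle hc)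
    (fderiv3_centre_comm hρ hF isCubeRotationData_quarterTurn hq) u v w

end Engine

section Jets

variable {V : E3 → E3} {ρ : ℝ}

/-- ★ **(J4) The cubic jet of the O-class** (`V ∈ C³`, O-equivariant on `ball 0 ρ` in the binder of `OctahedralCentreRigidity`):
`D³V(0)(u,v,w) = B·(⟪u,v⟫ w + ⟪v,w⟫ u + ⟪w,u⟫ v) + (A − 3B)·(uᵢvᵢwᵢ)ᵢ` — in the plane of the jets of `∇‖x‖⁴` and `∇Σxᵢ⁴`. -/
theorem fderiv3_centre_apply (hρ : 0 < ρ) (hV : ContDiffOn ℝ 3 V (ball 0 ρ))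
    (heq : ∀ x ∈ ball (0 : E3) ρ, ∀ σ s, IsCubeRotationData σ s → cubeRot σ s x ∈ ball (0 : E3) ρ →
      V (cubeRot σ s x) = cubeRot σ s (V x)) (u v w : E3) :
    fderiv ℝ (fderiv ℝ (fderiv ℝ V)) 0 u v w =
      fderiv ℝ (fderiv ℝ (fderiv ℝ V)) 0 (EuclideanSpace.single 0 (1 : ℝ)) (EuclideanSpace.single 0 (1 : ℝ))
            (EuclideanSpace.single 1 (1 : ℝ)) 1 •
          (⟪u, v⟫ • w + ⟪v, w⟫ • u + ⟪w, u⟫ • v) +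
        (fderiv ℝ (fderiv ℝ (fderiv ℝ V)) 0 (EuclideanSpace.single 0 (1 : ℝ)) (EuclideanSpace.single 0 (1 : ℝ))
              (EuclideanSpace.single 0 (1 : ℝ)) 0 -
            3 * fderiv ℝ (fderiv ℝ (fderiv ℝ V)) 0 (EuclideanSpace.single 0 (1 : ℝ)) (EuclideanSpace.single 0 (1 : ℝ))
              (EuclideanSpace.single 1 (1 : ℝ)) 1) •
          WithLp.toLp 2 (fun i => u i * v i * w i) :=
  fderiv3_centre_apply_of_generators hρ hV (equivariant_on_ball heq isCubeRotationData_halfTurn₀)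
    (equivariant_on_ball heq isCubeRotationData_halfTurn₁) (equivariant_on_ball heq isCubeRotationData_cycle)
    (equivariant_on_ball heq isCubeRotationData_quarterTurn) u v w

/-- **The divergence differentiated twice.**  For a `C³` field with `div V = 0` on the ball, the trace of the cubic jet vanishes:
`Σᵢ D³V(0)(u, w, eᵢ)ᵢ = 0`. -/
theorem fderiv3_trace_eq_zero_of_divFree (hρ : 0 < ρ) (hV : ContDiffOn ℝ 3 V (ball 0 ρ))
    (hdiv : ∀ x ∈ ball (0 : E3) ρ, VectorCalculus.divergence V x = 0) (u w : E3) :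
    ∑ i : Fin 3, fderiv ℝ (fderiv ℝ (fderiv ℝ V)) 0 u w (EuclideanSpace.single i (1 : ℝ)) i = 0 := by
  -- the trace functional `Λ M = Σᵢ (M eᵢ)ᵢ` on `ℝ³ →L ℝ³`
  let Λ : (E3 →L[ℝ] E3) →L[ℝ] ℝ :=
    ∑ i : Fin 3, (EuclideanSpace.proj i).comp (ContinuousLinearMap.apply ℝ E3 (EuclideanSpace.single i (1 : ℝ)))
  have hΛ : ∀ M : E3 →L[ℝ] E3, Λ M = ∑ i : Fin 3, M (EuclideanSpace.single i (1 : ℝ)) i := by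
    intro M
    simp [Λ]
  have hV2 : ContDiffOn ℝ 2 (fderiv ℝ V) (ball 0 ρ) := hV.fderiv_of_isOpen isOpen_ball (by norm_num)
  have hV2d : ∀ y ∈ ball (0 : E3) ρ, DifferentiableAt ℝ (fderiv ℝ V) y := fun y hy =>
    (hV2.differentiableOn (by norm_num)).differentiableAt (isOpen_ball.mem_nhds hy)
  have hW : ContDiffOn ℝ 1 (fderiv ℝ (fderiv ℝ V)) (ball 0 ρ) := hV2.fderiv_of_isOpen isOpen_ball (by norm_num)
  have hWd : DifferentiableAt ℝ (fderiv ℝ (fderiv ℝ V)) 0 :=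
    (hW.differentiableOn one_ne_zero).differentiableAt (isOpen_ball.mem_nhds (mem_ball_self hρ))
  -- `Λ(DV) = div V = 0` on the ball
  have k0 : ∀ y ∈ ball (0 : E3) ρ, Λ (fderiv ℝ V y) = 0 := by
    intro y hy
    have h := hdiv y hy
    rw [divergence_eq_sum_inner_fderiv (EuclideanSpace.basisFun (Fin 3) ℝ)] at h
    rw [hΛ]
    simpa [EuclideanSpace.inner_single_left] using h
  -- differentiate once: `Λ(D²V(y)[w]) = 0` on the ball
  have k1 : ∀ y ∈ ball (0 : E3) ρ, Λ (fderiv ℝ (fderiv ℝ V) y w) = 0 := fun y hy =>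
    apply_fderiv_eq_zero_of_forall_eq_zero Λ hy (hV2d y hy) k0 w
  -- differentiate again at the centre: `Λ(D³V(0)[u][w]) = 0`
  have k2 : Λ (fderiv ℝ (fun z => fderiv ℝ (fderiv ℝ V) z w) 0 u) = 0 :=
    apply_fderiv_eq_zero_of_forall_eq_zero Λ (mem_ball_self hρ) (hWd.clm_apply (differentiableAt_const w)) k1 u
  rw [fderiv_eval_eq hWd w u, hΛ] at k2
  exact k2

/-- ★ **(J4, divergence-free form): the cubic jet of a divergence-free O-germ (`C³`) is ONE multiple of `∇h₄`** — `A + 2B = 0`, so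
`D³V(0)(u,v,w) = B·(⟪u,v⟫ w + ⟪v,w⟫ u + ⟪w,u⟫ v − 5 (uᵢvᵢwᵢ)ᵢ) = −(5B/24)·D³(∇h₄)(0)(u,v,w)`, `h₄ = Σxᵢ⁴ − (3/5)‖x‖⁴`. -/
theorem fderiv3_centre_apply_of_divFree (hρ : 0 < ρ) (hV : ContDiffOn ℝ 3 V (ball 0 ρ))
    (heq : ∀ x ∈ ball (0 : E3) ρ, ∀ σ s, IsCubeRotationData σ s → cubeRot σ s x ∈ ball (0 : E3) ρ →
      V (cubeRot σ s x) = cubeRot σ s (V x))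
    (hdiv : ∀ x ∈ ball (0 : E3) ρ, VectorCalculus.divergence V x = 0) (u v w : E3) :
    fderiv ℝ (fderiv ℝ (fderiv ℝ V)) 0 u v w =
      fderiv ℝ (fderiv ℝ (fderiv ℝ V)) 0 (EuclideanSpace.single 0 (1 : ℝ)) (EuclideanSpace.single 0 (1 : ℝ))
          (EuclideanSpace.single 1 (1 : ℝ)) 1 •
        ((⟪u, v⟫ • w + ⟪v, w⟫ • u + ⟪w, u⟫ • v) - (5 : ℝ) • WithLp.toLp 2 (fun i => u i * v i * w i)) := by
  obtain ⟨hsym, hsym'⟩ := fderiv3_centre_symm hρ hV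
  have h0 := fderiv3_centre_comm hρ hV isCubeRotationData_halfTurn₀ (equivariant_on_ball heq isCubeRotationData_halfTurn₀)
  have h1 := fderiv3_centre_comm hρ hV isCubeRotationData_halfTurn₁ (equivariant_on_ball heq isCubeRotationData_halfTurn₁)
  have hc := fderiv3_centre_comm hρ hV isCubeRotationData_cycle (equivariant_on_ball heq isCubeRotationData_cycle)
  have hq := fderiv3_centre_comm hρ hV isCubeRotationData_quarterTurn (equivariant_on_ball heq isCubeRotationData_quarterTurn)
  set A := fderiv ℝ (fderiv ℝ (fderiv ℝ V)) 0 (EuclideanSpace.single 0 (1 : ℝ)) (EuclideanSpace.single 0 (1 : ℝ))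
    (EuclideanSpace.single 0 (1 : ℝ)) 0 with hA
  set B := fderiv ℝ (fderiv ℝ (fderiv ℝ V)) 0 (EuclideanSpace.single 0 (1 : ℝ)) (EuclideanSpace.single 0 (1 : ℝ))
    (EuclideanSpace.single 1 (1 : ℝ)) 1 with hB
  -- the trace relation `A + 2B = 0`
  have htr : A + 2 * B = 0 := by
    have h := fderiv3_trace_eq_zero_of_divFree hρ hV hdiv (EuclideanSpace.single 0 (1 : ℝ)) (EuclideanSpace.single 0 (1 : ℝ))
    rw [trilin_trace hsym hsym' h0 h1 hc hq, ← hB, ← hA] at h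
    simpa using h
  rw [trilin_eq hsym hsym' h0 h1 hc hq u v w, ← hB, ← hA, show A - 3 * B = B * (-5 : ℝ) by linarith, smul_sub, mul_smul,
    neg_smul, smul_neg, sub_eq_add_neg]

end Jets

section Tangent

variable {F : E3 → E3} {ρ : ℝ}

/-- **Tangency differentiated three times along a ray**: `F ∈ C³` on the ball, `F 0 = 0`, `⟪x, F x⟫ = 0` on the ball ⇒
`⟪u, D³F(0)(u,u,u)⟫ = 0` for every `u`. -/
theorem inner_fderiv3_self_eq_zero_of_tangent (hρ : 0 < ρ) (hF : ContDiffOn ℝ 3 F (ball 0 ρ)) (hF0 : F 0 = 0)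
    (htan : ∀ x ∈ ball (0 : E3) ρ, ⟪x, F x⟫ = 0) (u : E3) :
    ⟪u, fderiv ℝ (fderiv ℝ (fderiv ℝ F)) 0 u u u⟫ = 0 := by
  have hF2 : ContDiffOn ℝ 2 (fderiv ℝ F) (ball 0 ρ) := hF.fderiv_of_isOpen isOpen_ball (by norm_num)
  have hW : ContDiffOn ℝ 1 (fderiv ℝ (fderiv ℝ F)) (ball 0 ρ) := hF2.fderiv_of_isOpen isOpen_ball (by norm_num)
  have hFd : ∀ y ∈ ball (0 : E3) ρ, DifferentiableAt ℝ F y := fun y hy =>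
    (hF.differentiableOn (by norm_num)).differentiableAt (isOpen_ball.mem_nhds hy)
  have hF2d : ∀ y ∈ ball (0 : E3) ρ, DifferentiableAt ℝ (fderiv ℝ F) y := fun y hy =>
    (hF2.differentiableOn (by norm_num)).differentiableAt (isOpen_ball.mem_nhds hy)
  have hWd : ∀ y ∈ ball (0 : E3) ρ, DifferentiableAt ℝ (fderiv ℝ (fderiv ℝ F)) y := fun y hy =>
    (hW.differentiableOn one_ne_zero).differentiableAt (isOpen_ball.mem_nhds hy)
  -- the points `t u` lie in the ball for `t` near `0`
  have hball : ∀ᶠ t : ℝ in 𝓝 0, t • u ∈ ball (0 : E3) ρ := by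
    have hc : Continuous fun t : ℝ => t • u := continuous_id.smul continuous_const
    have h0 : (fun t : ℝ => t • u) 0 ∈ ball (0 : E3) ρ := by simp [hρ]
    exact hc.continuousAt.preimage_mem_nhds (isOpen_ball.mem_nhds h0)
  -- the scalar functions `⟪u, F⟫`, `⟪u, DF[u]⟫`, `⟪u, D²F[u,u]⟫`: differentiable on the ball, with the next one as `u`-derivative
  have e0 : ∀ y ∈ ball (0 : E3) ρ, DifferentiableAt ℝ (fun z => ⟪u, F z⟫) y ∧
      fderiv ℝ (fun z => ⟪u, F z⟫) y u = ⟪u, fderiv ℝ F y u⟫ := fun y hy => by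
    refine ⟨(differentiableAt_const u).inner ℝ (hFd y hy), ?_⟩
    rw [fderiv_inner_apply ℝ (differentiableAt_const u) (hFd y hy)]
    simp
  have e1 : ∀ y ∈ ball (0 : E3) ρ, DifferentiableAt ℝ (fun z => ⟪u, fderiv ℝ F z u⟫) y ∧
      fderiv ℝ (fun z => ⟪u, fderiv ℝ F z u⟫) y u = ⟪u, fderiv ℝ (fderiv ℝ F) y u u⟫ := fun y hy => by
    have hd : DifferentiableAt ℝ (fun z => fderiv ℝ F z u) y := (hF2d y hy).clm_apply (differentiableAt_const u)
    refine ⟨(differentiableAt_const u).inner ℝ hd, ?_⟩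
    rw [fderiv_inner_apply ℝ (differentiableAt_const u) hd, fderiv_eval_eq (hF2d y hy) u u]
    simp
  have e2 : ∀ y ∈ ball (0 : E3) ρ, DifferentiableAt ℝ (fun z => ⟪u, fderiv ℝ (fderiv ℝ F) z u u⟫) y ∧
      fderiv ℝ (fun z => ⟪u, fderiv ℝ (fderiv ℝ F) z u u⟫) y u = ⟪u, fderiv ℝ (fderiv ℝ (fderiv ℝ F)) y u u u⟫ :=
    fun y hy => by
    have hd : DifferentiableAt ℝ (fun z => fderiv ℝ (fderiv ℝ F) z u u) y :=
      ((hWd y hy).clm_apply (differentiableAt_const u)).clm_apply (differentiableAt_const u)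
    refine ⟨(differentiableAt_const u).inner ℝ hd, ?_⟩
    rw [fderiv_inner_apply ℝ (differentiableAt_const u) hd, fderiv_eval₂_eq (hWd y hy) u u u]
    simp
  -- three chain rules along the ray
  have d0 : ∀ᶠ t : ℝ in 𝓝 0, HasDerivAt (fun s : ℝ => ⟪u, F (s • u)⟫) ⟪u, fderiv ℝ F (t • u) u⟫ t := by
    filter_upwards [hball] with t ht
    obtain ⟨hd, he⟩ := e0 _ ht
    exact (hasDerivAt_ray hd).congr_deriv he
  have d1 : ∀ᶠ t : ℝ in 𝓝 0,
      HasDerivAt (fun s : ℝ => ⟪u, fderiv ℝ F (s • u) u⟫) ⟪u, fderiv ℝ (fderiv ℝ F) (t • u) u u⟫ t := by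
    filter_upwards [hball] with t ht
    obtain ⟨hd, he⟩ := e1 _ ht
    exact (hasDerivAt_ray hd).congr_deriv he
  have d2 : ∀ᶠ t : ℝ in 𝓝 0, HasDerivAt (fun s : ℝ => ⟪u, fderiv ℝ (fderiv ℝ F) (s • u) u u⟫)
      ⟪u, fderiv ℝ (fderiv ℝ (fderiv ℝ F)) (t • u) u u u⟫ t := by
    filter_upwards [hball] with t ht
    obtain ⟨hd, he⟩ := e2 _ ht
    exact (hasDerivAt_ray hd).congr_deriv he
  -- tangency along the ray: `⟪u, F(t u)⟫ = t⁻¹ ⟪t u, F(t u)⟫ = 0` near `0`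
  have z0 : (fun s : ℝ => ⟪u, F (s • u)⟫) =ᶠ[𝓝 0] 0 := by
    filter_upwards [hball] with t ht
    by_cases ht0 : t = 0
    · simp [ht0, hF0]
    · have h := htan _ ht
      rw [real_inner_smul_left] at h
      simpa [ht0] using h
  have z1 := eventuallyEq_zero_of_hasDerivAt d0 z0
  have z2 := eventuallyEq_zero_of_hasDerivAt d1 z1
  have z3 := eventuallyEq_zero_of_hasDerivAt d2 z2
  simpa using z3.eq_of_nhds

end Tangent

section Vorticity

variable {V : E3 → E3} {ρ : ℝ}

/-- ★★ **(J4′) The vorticity of an O-equivariant UNTHREADED `C⁴` germ is 3-flat at the centre**: `D³(curl V)(0) = 0` (`ω` is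
O-equivariant on the ball, so `D³ω(0)` has the normal form of (J4); tangency along rays kills both constants).  No NS input. -/
theorem fderiv3_curl_centre_eq_zero (hρ : 0 < ρ) (hV : ContDiffOn ℝ 4 V (ball 0 ρ))
    (heq : ∀ x ∈ ball (0 : E3) ρ, ∀ σ s, IsCubeRotationData σ s → cubeRot σ s x ∈ ball (0 : E3) ρ →
      V (cubeRot σ s x) = cubeRot σ s (V x))
    (hunth : ∀ x ∈ ball (0 : E3) ρ, ⟪x, curl V x⟫ = 0) :
    fderiv ℝ (fderiv ℝ (fderiv ℝ (curl V))) 0 = 0 := by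
  have hV1 : ContDiffOn ℝ 1 V (ball 0 ρ) := hV.of_le (by norm_num)
  have hω : ContDiffOn ℝ 3 (curl V) (ball 0 ρ) := by
    rw [curl_eq_curlCLM_comp]
    exact curlCLM.contDiff.comp_contDiffOn (hV.fderiv_of_isOpen isOpen_ball (by norm_num))
  have hω0 : curl V 0 = 0 := curl_centre_eq_zero hρ hV1 heq
  obtain ⟨hsym, hsym'⟩ := fderiv3_centre_symm hρ hω
  exact trilin_eq_zero_of_inner_self hsym hsym'
    (fderiv3_centre_comm hρ hω isCubeRotationData_halfTurn₀
      (curl_equivariant_halfTurn isCubeRotationData_halfTurn₀ hV1 (equivariant_on_ball heq isCubeRotationData_halfTurn₀)))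
    (fderiv3_centre_comm hρ hω isCubeRotationData_halfTurn₁
      (curl_equivariant_halfTurn isCubeRotationData_halfTurn₁ hV1 (equivariant_on_ball heq isCubeRotationData_halfTurn₁)))
    (fderiv3_centre_comm hρ hω isCubeRotationData_cycle
      (curl_equivariant_cycle hV1 (equivariant_on_ball heq isCubeRotationData_cycle)))
    (fderiv3_centre_comm hρ hω isCubeRotationData_quarterTurn
      (curl_equivariant_quarterTurn hV1 (equivariant_on_ball heq isCubeRotationData_quarterTurn)))
    (inner_fderiv3_self_eq_zero_of_tangent hρ hω hω0 hunth)

end Vorticity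

section Global

variable {V : E3 → E3}

/-- **(J1′)(J2″)(J3)(J4′), global form: the vorticity 3-jet of an O-equivariant unthreaded `C⁴` field on `ℝ³` vanishes at the centre.** -/
theorem curl_three_flat_of_isEquivariant (hV : ContDiff ℝ 4 V) (heq : IsEquivariant octahedral V)
    (hunth : ∀ x, ⟪x, curl V x⟫ = 0) :
    curl V 0 = 0 ∧ fderiv ℝ (curl V) 0 = 0 ∧ fderiv ℝ (fderiv ℝ (curl V)) 0 = 0 ∧
      fderiv ℝ (fderiv ℝ (fderiv ℝ (curl V))) 0 = 0 := by
  have hb := ballBinder_of_isEquivariant heq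
  exact ⟨curl_centre_eq_zero one_pos (hV.of_le (by norm_num)).contDiffOn hb,
    fderiv_curl_centre_eq_zero one_pos (hV.of_le (by norm_num)).contDiffOn hb,
    fderiv_fderiv_curl_centre_eq_zero one_pos (hV.of_le (by norm_num)).contDiffOn hb,
    fderiv3_curl_centre_eq_zero one_pos hV.contDiffOn hb fun x _ => hunth x⟩

end Global

end CentreFlat

end Summit.NavierStokesRegularity.NavierStokesRegularity.Theorems.PoloidalLiouville.Platonic

end
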